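import Summits.FinalStateConjecture.FinalStateConjecture.Theses.StarvedNecks
import Summits.FinalStateConjecture.FinalStateConjecture.Theorems.NecksCertify.Negative.NecksCertifyFalseOfComovingPairWitness

/-!
# Disproof of `NeckGapDecay` — findings (cdisprove seat, crux stmt-FinalStateConjecture-16768, route StarvedNecks)

Refuter seat `refuter-cdisprove-stmt-FinalStateConjecture-16768-0`, generation 1, cycle 1 (2026-08-17).
Everything below the module docstring is `sorry`-free and `lean check`ed (rc 0; axioms `propext`,
`Classical.choice`, `Quot.sound`).  Prose lives in docstrings / comments.  Predecessor record (the parent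
crux `NecksCertify`, of which this decl is the PHYSICS half): `Cruxes/NecksCertify/Disproof.lean` gen 1–3
(§A no unconditional `¬`; §B/§D load-bearing list; §F focusing packets; §G comoving pair) — cited, not
repeated.  One-shot refuter attacks on THIS decl (item notes 2026-08-17T00:28Z/00:37Z, EVIDENCE.md ×2):
survives; DV / `Hf`(3) / `Hc`(2) load-bearing; exact boosted Schwarzschild instantiation of (G1)–(G5) on
paper.  This file adds kernel-checked structure and three new paper findings.

## Verdict (cycle 1)

NO KILL.  (i) STRUCTURAL: `¬ NeckGapDecay` needs an admissible datum WITH a maximal vacuum Cauchy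
development carrying an honest `C⁴` decomposition with `0 < d.N` and a hole whose gap certificate fails;
`VacuumCauchyDevelopment.IsMaximal` is provable for no constructible spacetime of the tree and Minkowski
forces `N = 0`, where the conclusion is VACUOUS (`gapCert_of_N_eq_zero` below) — inherited from the
parent's §A, re-verified on the rev-7 text (`readback`, `Iff.rfl`, farm olean current: factor `3`).
(ii) SUBSTANTIVE: every late-time mechanism this seat could name DECAYS on the neck in the crux's own
rate-free currency (unweighted `C²` sup → 0 on `{tᵢ = τ, rᵢ ≤ W(x⁰)}`, `W ≍ 3ρᵢ`): hole-borne emission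
`F^{(k)}(u)/r`, `u = t − r ≥ t − 3ρ → ∞`, `k ≤ 4` certified rate-free at the cylinder; data-borne incoming
content capped by `o₂` provenance × flat `C⁴` (§C below, including the ANGULAR order-3 entry the route
text feared); cross-hole content `(ρ/dᵢⱼ)²`, `dᵢⱼ ≥ c·t` under DV; Kerr tail `M/r`; memory/BMS offsets
are absorbed by the final frame `(Λᵢ, cᵢ)` and the `u → ∞` limit; Price/Luk–Oh tails decay.  What is
genuinely open is PROOF TECHNIQUE (C⁰ a-priori control on the gap; the line `Sketch` =
connection-level cones attacks exactly that), not a candidate counterexample.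

## Index of kernel-checked content

* §1 `HonestCore`, `HonestFar`, `DistinctVelocities`, `GapCertWith c`, `NeckGapDecayWith c` — the
  crux's `let`-bundles and conclusion named VERBATIM; `readback : NeckGapDecay ↔ NeckGapDecayWith 3`
  (`Iff.rfl`; also certifies that the farm build carries the rev-7 wall `3ρᵢ + 2`, cf. the stale-olean
  warning in the item notes — resolved).
* §2 `gapCert_of_N_eq_zero` — `N = 0`: the conclusion is vacuous (intended; dispersal is p116546's).
* §3 `gapCert_of_constWall` — THE BOUNDED-TUBE REDUCTION: for ANY decomposition and hole `i`, if the
  input's excision is eventually dominated by a constant wall (`3ρᵢ(s) + 2 ≤ W₀` for `s ≥ τ₁`), then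
  (G0)–(G5) follow from the STRUCTURE (fixed-radius `Cᵏ → C²` convergence at radius `W₀`, late-chart
  open embedding) plus exactly two inputs: `Hc`(3) (relative closedness) and the ORIENTATION SIGN (G4)
  on the finite collar `R₀ ≤ rᵢ ≤ W₀`.  So all the physics of the crux sits in `ρᵢ → ∞` (forced for
  honest inputs with a real hole — paper, rattack note; the Lean-visible statement is silent there), and
  for thin/bounded tubes the crux IS the sign lemma the lead has already isolated ("orientation anchor",
  PICKED.md).  Witness: `R₁ = R₀`, `W ≡ W₀`, `Ψg = d.chart i`.
* §T TARGETS: the 7 registered stubs of `Lines/Sketch.lean` + 2 of `Lines/birth.lean` — all TRUE on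
  paper (none killed); S3b PROVED here (`timelikeOfSmallDeviation`, candidate proof for the worker); S2's
  minimal hypotheses (`Hc`(1),(3), `O = exteriorOf`, Cauchy achronality — NOT `Hc`(2)); S3a's orthochronous and
  monotone-wall hypotheses are load-bearing — KERNEL-CHECKED, p138588 (`not_bandAnchoredPaths_without_…`).
* §4 LANDED / PROPOSED model facts (separate `Negative/` files, cited here by name; import them once in
  the tree): `Theorems/NeckGapDecay/Negative/ExactSchwarzschildLateModel.lean` (p137987: `SchwGap.decompK`
  — exact Schwarzschild, `N = 1`, `τ₀ = 1`, any `Cᵏ`; `flat_mem_causalPast_slab`) and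
  `…/ExactSchwarzschildGapCertificate.lean` (p138282: `GapCertificate` verbatim; `honestCore_decompK`,
  `honestFar_decompK`, `distinctVelocities_decompK`, `gapCertificate_decompK`,
  `exists_N_one_honest_gapCertified`): the antecedent `Hc ∧ Hf ∧ DV` has a genuine `N = 1` inhabitant on
  which (G0)–(G5) hold with the INTENDED witness `R₁ = R₀`, `τ₁ = τ₀`, `W = 3ρ + 2`, `Ψg = Ψᵢ` — in Lean,
  not on paper: no clause-typing slip ((G5) at the horizon: closure adds only horizon points ∉ O; (G1)
  open embedding of the open sub-wall tube; the flat-time wall argument `x.1 0`).  By-product (model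
  hygiene, not a defect of the crux): the parent's model `SchwModel.decomp` (`τ₀ = 0`) VIOLATES `Hf`(1)
  near `t → 0⁺` (its wall `R₀ + 1 + √t` is superluminal there); `τ₀ = 1` and tilted escape lines fix it.

## §A  Why no unconditional `¬` (inherited; re-checked on the rev-7 text)

As in the parent's §A: the antecedent needs `D ∈ admissibleVacuumData X`, `𝒟 : VacuumCauchyDevelopment D`
with `𝒟.IsMaximal`, and `0 < d.N`; the tree's only vacuum Cauchy development is Minkowski (maximality
unproved), where an honest `C²`-or-better decomposition has `N = 0` (a hole chart would make flat slabs
converge in `C²` to Kerr with `M > 0`).  With `N = 0` the conclusion `∀ i : Fin d.N, …` is vacuous (§2).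
Hence neither `¬S`, nor `S`, nor any `_false_without_<H>` over the crux's own quantifier prefix is
attainable sorry-free; load-bearing analysis is paper (§B) or lives on hand-built spacetimes (§4, the
`Core` shape over an arbitrary `Spacetime`, which the crux does not quantify over).

## §B  Load-bearing hypotheses (paper; witnesses precise enough to type once a BH MGHD exists)

* DV (`Λᵢe₀ ≠ Λⱼe₀`): LOAD-BEARING.  Witness family: a threshold ("parabolic") comoving pair, labels
  `Λᵢe₀ = Λⱼe₀`, physical separation `d(t) ≍ t^{2/3}`, honest FAT tube `ρᵢ := 2d(t)` (the input may
  under-report: only `ρᵢ/t → 0` is asked).  Then `W ≥ 3ρᵢ + 2 ≥ 6d(t)` and (G1)–(G3) ask for a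
  `C²`-near-isometric embedding `Ψg` of the Kerrᵢ ball of radius `6d` pinned (G2) to hole `i`, with image
  in `O` (G1); its outer sphere is isotopic in `Σ ∖ (holes)` to a small sphere about hole `i`, so it does
  NOT enclose hole `j`, yet every curve from hole `i`'s near zone to that sphere has length `≥ 6d − R₁ − 1
  − o(d)` while hole `j` sits at distance `d` — contradiction (Schoenflies + near-isometric length bound;
  the parent's §D "a near-isometric ball cannot dodge a second hole").  Same physics `H′` as the landed
  `NecksCertify_false_of_ComovingPairWitness` (imported below, §6); no metric-free combinatorial core
  exists for THIS decl (its clauses are metric), so no Lean lemma modulo `H′` is offered — it would be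
  tautological (`H ↔ ¬ NeckGapDecayWithoutDV`).
* `Hf`(3) (Voronoi `C⁰` honesty): LOAD-BEARING against an UNLABELLED comoving companion inside tube `i`
  (same enclosure argument with `N = 1` labels and a second physical hole); also supplies timelikeness of
  `Λᵢe₀` on the collar for (G4).
* `Hc`(2) (anchoring below later discs): fixes the SIGN in (G4) on `[R₁, R₁ + 1]` where `Ψg = Ψᵢ` is
  forced by (G2): with a time function of the globally hyperbolic MGHD, `M(τ) := max_{disc τ} T` would
  be strictly decreasing for past-directed `Λᵢe₀`-lines yet `Hc`(2) gives `M(τ) ≤ M(τ₂)` for `τ < τ₂`;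
  the endpoint case is excluded by `Hc`(3) + `O ⊆ J⁺(ιX)`.  (No exact model isolates it: reversing the
  orientation of a Kerr–Schild patch cannot be absorbed by the hole chart — ingoing vs outgoing form —
  only by the flat chart, and then the structure's covering clause fails; §4 hygiene note.)
* `O = exteriorOf 𝒟 d.charted` together with `D ∈ admissibleVacuumData` (the `o₂(r⁻¹)/o₁(r⁻²)` fall-off):
  LOAD-BEARING IN THE LINEAR MODEL (§C(2)): without data provenance, focusing packet trains respecting
  the cylinder `C⁴` certificate, the flat `C⁴` certificate and `C⁰` honesty have gap-focus `C²` size up to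
  `(δρ)^{2/3}/10^{1/3} → ∞` for slowly decaying certificates `δ(τ) ≫ 1/ρ(τ)`.
* `Hc`(1) (`100Mᵢ ≤ R₀`, sub-extremal, orthochronous): analytic smallness only (`2M/r ≤ 1/50` on the
  collar; timelike cone algebra); `Hc`(3): used verbatim for (G5) (§3); `Hc`(4), `Hf`(1), `Hf`(2):
  possibly unnecessary for THIS decl (they police the flat chart, which enters only through the
  certified zone `[ρ, 3ρ + 2]` where `Ψg` is re-built from it — the seam, inside this crux since rev 5).

## §C  Attacks run this cycle that found nothing (logged so nobody repeats them)

(1) THE ORDER-3 ANGULAR W-TEST (route text, "why it might fail" #1 / kill criterion (2) / cheapest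
falsifier (1)): MOOT by power counting — no kit job needed.  Incoming linear content with angular scale
`ℓ(v)` from data at radius `v ≍ t`, tube `ρ = t^θ`: `o₂` at `t = 0` gives `ℓ ≪ v^{a/2}` (amplitude
`v^{−a}`), the flat `C⁴` certificate at the inner edge `r = t^θ` gives `ℓ ≪ t^{(a+5θ)/4}`, while a
non-starving order-3 cone ledger `ρ⁻¹∫_{shell}|∇³ψ|² ≍ ℓ⁶ t^{−2a−6θ} ↛ 0` needs `ℓ ≳ t^{a/3+θ}`; the window
requires `a/3 + θ < a/4 + 5θ/4` (i.e. `θ > a/3`) AND `a/3 + θ < a/2` (i.e. `θ < a/6`) — empty.  Thin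
bursts / long trains: ledger₃ ≲ (o₂ size)·(C⁴ size)·ρ⁰ → 0 (the "geometric mean of the two caps" of the
route text holds at order 3 for angular as for radial wildness).  High-ℓ content moreover turns at
`r ≍ ℓ/μ` and never reaches the shell.  So the [cone] hypothesis of M2 at order 3 is NOT violated by
angularly wild admissible data; the route's fear #1 can be struck.
(2) FOCUSING PACKETS WITHOUT PROVENANCE (what `o₂` buys): a packet of frequency `ω`, width `≲ ρ` at radius
`3ρ` (flat-certified: amplitude `A′ ≤ δ/ω⁴`, `A′ ≤ 1/10`) focusing to a point of the C⁰-only gap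
`{R_g < r ≤ ρ}` gains `ρω`; `C⁰` honesty at the focus gives `A′ρω ≤ 1/10`; the `C²` size at the focus is
`A′ρω³ = δρ/ω ≤ (δρ)^{2/3}/10^{1/3}` at the optimum `ω = (10δρ)^{1/3}` — UNBOUNDED unless `δ = O(1/ρ)`.
With provenance: incoming packets come from data at radius `≍ t` (`o₂`: `A ≍ o(t^{−1})` with two weighted
derivatives) — the parent's §F / rattack computation `C² ≤ o(√ρ/t) → 0`; outgoing refocusing from the
cylinder has aperture `R₁`, gain `≤ R₁²ω/ρ`, `C² ≤ δ R₁²/(ρω) → 0`.  Conclusion: any proof must use that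
gap content is data-borne-with-`o₂` or cylinder-borne, i.e. `O = J⁺(ιX) ∩ I⁻(charted)` AND admissibility —
the crux over an arbitrary spacetime/decomposition ("Core" shape) is FALSE in the linear model.
(3) WALL SIZE: any sublinear wall keeps `u = t − r → ∞` on the slab, so "∃ W ≥ 3ρ + 2" is not where it
could fail; a LINEAR wall `W = c·t` is false for `N ≥ 2` (another hole inside the wall) and plausible for
`N = 1`, `c < 1` — the crux asks neither.  Degenerate excisions (`ρᵢ` bounded / negative, legal for the
structure) make the conclusion CHEAP (§3), never false.
(4) INPUT-CHART CERTIFICATION (strengthening "Ψg := d.chart i"): FALSE for honest inputs — twist the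
identity chart of exact Schwarzschild by `κ(t, r, ω) = (t, r, R_{θ(t,r)}ω)`, `θ = ε r⁻² sin r²` beyond a
receding radius `λ(t) → ∞` (`= id` inside): fixed-radius convergence, `Hc`, `Hf`(3) (`C⁰` error `O(ε)`)
all hold, but `∂ᵣ²` of the deviation is `≍ ε r²` on the gap.  So the re-gauging freedom in (G1)/(G2) is
essential (known: AUDIT-c4 belt trick; recorded here as the reason no "certify Ψᵢ itself" stub may be
written).  Not kernel-checked (needs `C²` lower bounds of a twisted pull-back; out of budget).
(5) Literature / negatives: `ledger negatives` for the summit — nothing on necks; barrier catalogue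
(`PriceLawTail`, `SbierskiTrappingObstruction`, `KerrNullGeodesicGaussianBeams`,
`WaveCoordinatesNullConditionFailure`, `KehrbergerLogarithmicAsymptotics`, `NonSmoothNullInfinity`): none
bites a rate-free `C²` statement on `r ≥ 100M` (beams = §C(2), excluded by provenance).

## §D  Briefing for the lead / provers

* Bounded tubes are free modulo the sign (§3): prove the orientation anchor FIRST; it is the only
  non-structural input on every finite collar, and (G2) forces it at `[R₁, R₁+1]` for every input.
* Do not write a stub certifying the INPUT chart on the gap (§C(4)); `Ψg` must be re-built.
* The [cone]/flux hypotheses at order ≤ 3 are safe against admissible angular wildness (§C(1)); the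
  honest residual is nonlinear (refocused, nonlinearly generated incoming radiation — Luk–Oh), for which
  no computable toy exists in this seat's reach.
* `SchwModel.decomp` (τ₀ = 0) is NOT an `Hf`-honest input; use `SchwGap.decompK` (τ₀ = 1) for instantiation
  tests of anything carrying `Hf`(1).
-/

noncomputable section

open scoped Manifold ContDiff Topology ENNReal
open Filter Set Literature.Geometry.Lorentzian

namespace Summit.FinalStateConjecture.FinalStateConjecture.Cruxes.NeckGapDecay.Disproof

set_option linter.dupNamespace false
-- instance search through nested operator types `E4 →L E4 →L E4 →L ℝ` (as in the tree files)
set_option maxSynthPendingDepth 3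

/-! ## §1 The crux's bundles and conclusion, named verbatim; read-back -/

/-- `HonestCore 𝓢 O k d R₀` = the crux's `Hc` (verbatim): sub-extremal holes, `100·Mᵢ ≤ R₀`,
orthochronous boosts; anchoring of hole-late points below later discs of every radius `≥ R₀`;
relative closedness of late tube portions; future-oriented flat chart. -/
def HonestCore (𝓢 : Spacetime.{0} 4) (O : Set 𝓢.carrier) (k : ℕ) (d : FinalStateDecomposition 𝓢 O k)
    (R₀ : ℝ) : Prop :=
  let B := d.background; let t := fun i ↦ (B i).time; let r := fun i ↦ (B i).radius; let Ψ := d.chart;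
  (∀ i, Kerr.IsSubextremal (d.mass i) (d.spin i) ∧ 100 * d.mass i ≤ R₀ ∧ 0 < ((d.motion i).1 : E4 ≃L[ℝ] E4) (E4.basisVector 0) 0) ∧
    (∀ i (ϱ τ₂ : ℝ), R₀ ≤ ϱ → d.τ₀ < τ₂ → Ψ i '' {x | d.τ₀ < t i x.1 ∧ t i x.1 < τ₂ ∧ r i x.1 < ϱ} ⊆ 𝓢.metric.causalPast 𝓢.timeOrientation (Ψ i '' (B i).truncTimeSlab ϱ τ₂)) ∧
    (∀ i (τ' : ℝ) (ϱ : ℝ → ℝ), Continuous ϱ → d.τ₀ < τ' → let A := Ψ i '' {x | τ' ≤ t i x.1 ∧ r i x.1 ≤ ϱ (t i x.1)}; closure A ∩ O ⊆ A) ∧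
    (∀ y : d.flatDomain, d.τ₀ < y.1 0 → 𝓢.timeOrientation.IsFutureDirected (mfderiv 𝓘(ℝ, E4) (𝓡 4) d.flatChart y (E4.basisVector 0)))

/-- `HonestFar 𝓢 O k d R₀` = the crux's `Hf` (verbatim): flat-late points below later flat slabs;
closures of far flat slabs are flat points; eventually each hole chart is `C⁰`-honest on its own
coordinate Voronoi cell beyond `R₀`. -/
def HonestFar (𝓢 : Spacetime.{0} 4) (O : Set 𝓢.carrier) (k : ℕ) (d : FinalStateDecomposition 𝓢 O k)
    (R₀ : ℝ) : Prop :=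
  let B := d.background; let t := fun i ↦ (B i).time; let r := fun i ↦ (B i).radius; let Φ := d.flatChart;
  (∀ τ₂ : ℝ, d.τ₀ < τ₂ → Φ '' {y | d.τ₀ < y.1 0 ∧ y.1 0 < τ₂} ⊆ 𝓢.metric.causalPast 𝓢.timeOrientation (Φ '' (Minkowski.backgroundOn d.flatDomain).timeSlab τ₂)) ∧
    (∀ τ' : ℝ, d.τ₀ < τ' → closure (Φ '' {y | τ' ≤ y.1 0 ∧ ∀ i, d.excision i (y.1 0) + 1 ≤ r i y.1}) ⊆ Φ '' {y | τ' ≤ y.1 0}) ∧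
    (∀ i, ∃ T : ℝ, supCkENorm (Subtype.val '' {x : (B i).domain | T ≤ t i x.1 ∧ R₀ ≤ r i x.1 ∧ ∀ j, j ≠ i → r i x.1 ≤ r j x.1}) 0 (𝓢.deviationExtend (B i) (d.chart i)) ≤ ENNReal.ofReal (1 / (10 * ‖(((d.motion i).1 : E4 ≃L[ℝ] E4) : E4 →L[ℝ] E4)‖ ^ 2)))

/-- Pairwise distinct asymptotic four-velocities (`DV`, the rev-2 repair C′ of the parent crux). -/
def DistinctVelocities {𝓢 : Spacetime.{0} 4} {O : Set 𝓢.carrier} {k : ℕ}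
    (d : FinalStateDecomposition 𝓢 O k) : Prop :=
  ∀ i j : Fin d.N, i ≠ j →
    ((d.motion i).1 : E4 ≃L[ℝ] E4) (E4.basisVector 0) ≠ ((d.motion j).1 : E4 ≃L[ℝ] E4) (E4.basisVector 0)

/-- The GAP CERTIFICATE of hole `i` with wall factor `c` (tree text: `c = 3`; retired rev-6 text of
stmt-18059: `c = 1`) — the crux's conclusion, verbatim: (G0) `R₁ ≥ R₀`, `τ₁ ≥ τ₀`, continuous wall
`W ≥ c·ρᵢ + 2` from flat time `τ₁`; (G1) `Ψg` smooth open embedding of the late sub-wall tube into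
`d.charted`; (G2) `Ψg = d.chart i` inside `R₁ + 1`; (G3) `C²` deviation from boosted Kerrᵢ → 0 on the
hole slabs out to the wall; (G4) future-directed `Λᵢe₀`-lines on `R₁ ≤ rᵢ ≤ W(x⁰)` from `τ₁`; (G5)
relative closedness (in `O`) of closed sub-wall tube portions. -/
def GapCertWith (c : ℝ) (𝓢 : Spacetime.{0} 4) (O : Set 𝓢.carrier) (k : ℕ)
    (d : FinalStateDecomposition 𝓢 O k) (R₀ : ℝ) (i : Fin d.N) : Prop :=
  ∃ (R₁ τ₁ : ℝ) (W : ℝ → ℝ) (Ψg : (d.background i).domain → 𝓢.carrier), let B:=d.background i; let t:=B.time; let r:=B.radius; R₀ ≤ R₁ ∧ d.τ₀ ≤ τ₁ ∧ Continuous W ∧ (∀ s, τ₁ ≤ s → c * d.excision i s + 2 ≤ W s) ∧ (let U : Set B.domain := {x | τ₁ < t x.1 ∧ r x.1 < W (x.1 0) + 1}; ContMDiffOn 𝓘(ℝ, E4) (𝓡 4) ∞ Ψg U ∧ Topology.IsOpenEmbedding (U.restrict Ψg) ∧ Ψg '' U ⊆ d.charted) ∧ (∀ x : B.domain, r x.1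 ≤ R₁ + 1 → Ψg x = d.chart i x) ∧ Tendsto (fun τ ↦ supCkENorm (Subtype.val '' {x : B.domain | t x.1 = τ ∧ r x.1 ≤ W (x.1 0)}) 2 (𝓢.deviationExtend B Ψg)) atTop (𝓝 0) ∧ (∀ x : B.domain, τ₁ ≤ t x.1 → R₁ ≤ r x.1 → r x.1 ≤ W (x.1 0) → 𝓢.timeOrientation.IsFutureDirected (mfderiv 𝓘(ℝ, E4) (𝓡 4) Ψg x (((d.motion i).1 : E4 ≃L[ℝ] E4) (E4.basisVector 0)))) ∧ (∀ (τ' : ℝ) (ϱ : ℝ → ℝ), Continuous ϱ → τ₁ < τ' → (∀ x : B.domain, τ' ≤ t x.1 → r x.1 ≤ ϱ (t x.1) → r x.1 ≤ W (x.1 0)) → closure (Ψg '' {x | τ' ≤ t x.1 ∧ r x.1 ≤ ϱ (t x.1)}) ∩ O ⊆ Ψg '' {x | τ' ≤ t x.1 ∧ r x.1 ≤ ϱ (t x.1)})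

/-- The crux with wall factor `c`, in structured form (quantifier prefix verbatim). -/
def NeckGapDecayWith (c : ℝ) : Prop :=
  ∀ (X : Type) [TopologicalSpace X] [ChartedSpace E3 X] [IsManifold (𝓡 3) ∞ X] [ConnectedSpace X]
    (D : InitialDataSet (𝓡 3) X), D ∈ admissibleVacuumData X → ∀ 𝒟 : VacuumCauchyDevelopment D, 𝒟.IsMaximal →
    ∀ (O : Set 𝒟.carrier) (d : FinalStateDecomposition 𝒟.toSpacetime O 4) (R₀ : ℝ),
    O = exteriorOf 𝒟.toCauchyDevelopment d.charted → HonestCore 𝒟.toSpacetime O 4 d R₀ →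
    HonestFar 𝒟.toSpacetime O 4 d R₀ → DistinctVelocities d → ∀ i : Fin d.N, GapCertWith c 𝒟.toSpacetime O 4 d R₀ i

/-- **Read-back.**  The tree's `NeckGapDecay` IS `NeckGapDecayWith 3`, definitionally (`Iff.rfl`): the
structured names above are verbatim, and the farm build carries the rev-7 wall `3ρᵢ + 2` (the item
notes' stale-olean warning of 2026-08-17T00:35Z — compiled factor `1` — no longer applies). -/
theorem readback : Theses.StarvedNecks.NeckGapDecay ↔ NeckGapDecayWith 3 := Iff.rfl

/-! ## §2 `N = 0`: the conclusion is vacuous -/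

/-- With no hole (`d.N = 0`) the conclusion `∀ i : Fin d.N, GapCertWith c …` holds vacuously: the crux
says nothing about dispersing developments (their exhaustiveness is the parent's landed `N = 0` case,
p116183/p116546).  This is why Minkowski — the tree's only vacuum Cauchy development — can never refute
or confirm the crux (§A). -/
theorem gapCert_of_N_eq_zero {c : ℝ} {𝓢 : Spacetime.{0} 4} {O : Set 𝓢.carrier} {k : ℕ}
    (d : FinalStateDecomposition 𝓢 O k) (R₀ : ℝ) (hN : d.N = 0) :
    ∀ i : Fin d.N, GapCertWith c 𝓢 O k d R₀ i :=
  fun i ↦ (Fin.cast hN i).elim0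

/-! ## §3 The bounded-tube reduction: with a constant wall, (G0)–(G5) = structure + `Hc`(3) + the sign -/

/-- Hole time `tᵢ = (Λᵢ⁻¹(x − cᵢ))⁰` is continuous on `E4`. -/
theorem continuous_background_time {𝓢 : Spacetime.{0} 4} {O : Set 𝓢.carrier} {k : ℕ}
    (d : FinalStateDecomposition 𝓢 O k) (i : Fin d.N) : Continuous (d.background i).time :=
  (PiLp.continuous_apply 2 _ 0).comp (continuous_poincareInv _ _)

/-- Hole radius `rᵢ = r(aᵢ, Λᵢ⁻¹(x − cᵢ))` is continuous on `E4`. -/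
theorem continuous_background_radius {𝓢 : Spacetime.{0} 4} {O : Set 𝓢.carrier} {k : ℕ}
    (d : FinalStateDecomposition 𝓢 O k) (i : Fin d.N) : Continuous (d.background i).radius :=
  (Kerr.continuous_radius _).comp (continuous_poincareInv _ _)

/-- **BOUNDED-TUBE REDUCTION.**  For ANY spacetime, region, `Cᵏ` decomposition (`k ≥ 2`), `R₀` and hole
`i`: if from some chart time `τ₁ ≥ τ₀` the input's excision is dominated by a CONSTANT wall,
`c·ρᵢ(s) + 2 ≤ W₀` (`s ≥ τ₁`; no lower bound on `W₀` is needed), then the gap certificate with wall factor `c` follows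
from (i) the STRUCTURE (late-chart smoothness/open embedding; fixed-radius `Cᵏ` convergence at radius
`W₀`), (ii) `Hc`(3) for hole `i` (relative closedness of late tube portions), and (iii) the SIGN: the
input chart's `Λᵢe₀`-lines are future-directed on the finite collar `R₀ ≤ rᵢ ≤ W₀` from `τ₁`.  Witness
`R₁ = R₀`, `W ≡ W₀`, `Ψg = d.chart i`.  Reading: all the physics of `NeckGapDecay` is in `ρᵢ → ∞`; on
bounded tubes the crux is exactly the orientation anchor. -/
theorem gapCert_of_constWall {c : ℝ} {𝓢 : Spacetime.{0} 4} {O : Set 𝓢.carrier} {k : ℕ} (hk : 2 ≤ k)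
    (d : FinalStateDecomposition 𝓢 O k) (R₀ : ℝ) (i : Fin d.N) (τ₁ W₀ : ℝ) (hτ₁ : d.τ₀ ≤ τ₁)
    (hthin : ∀ s, τ₁ ≤ s → c * d.excision i s + 2 ≤ W₀)
    (hclosed : ∀ (τ' : ℝ) (ϱ : ℝ → ℝ), Continuous ϱ → d.τ₀ < τ' →
      closure (d.chart i '' {x | τ' ≤ (d.background i).time x.1 ∧
        (d.background i).radius x.1 ≤ ϱ ((d.background i).time x.1)}) ∩ O ⊆
      d.chart i '' {x | τ' ≤ (d.background i).time x.1 ∧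
        (d.background i).radius x.1 ≤ ϱ ((d.background i).time x.1)})
    (hsign : ∀ x : (d.background i).domain, τ₁ ≤ (d.background i).time x.1 →
      R₀ ≤ (d.background i).radius x.1 → (d.background i).radius x.1 ≤ W₀ →
      𝓢.timeOrientation.IsFutureDirected
        (mfderiv 𝓘(ℝ, E4) (𝓡 4) (d.chart i) x (((d.motion i).1 : E4 ≃L[ℝ] E4) (E4.basisVector 0)))) :
    GapCertWith c 𝓢 O k d R₀ i := by
  set B := d.background i with hB
  have hlc := d.isLateChart i
  refine ⟨R₀, τ₁, fun _ ↦ W₀, d.chart i, le_rfl, hτ₁, continuous_const, hthin, ⟨?_, ?_, ?_⟩,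
    fun x _ ↦ rfl, ?_, ?_, ?_⟩
  · -- (G1a) smoothness from the structure
    exact hlc.contMDiff.contMDiffOn
  · -- (G1b) the sub-wall late tube is an open subset of the late region; restrict the open embedding
    set U : Set B.domain := {x | τ₁ < B.time x.1 ∧ B.radius x.1 < W₀ + 1} with hU
    have hUopen : IsOpen U :=
      (isOpen_lt continuous_const ((continuous_background_time d i).comp continuous_subtype_val)).inter
        (isOpen_lt ((continuous_background_radius d i).comp continuous_subtype_val) continuous_const)
    have hLopen : IsOpen (B.lateRegion d.τ₀) :=
      isOpen_lt continuous_const ((continuous_background_time d i).comp continuous_subtype_val)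
    have hUL : U ⊆ B.lateRegion d.τ₀ := fun x hx ↦ lt_of_le_of_lt hτ₁ hx.1
    have hι : Topology.IsOpenEmbedding (Set.inclusion hUL) := by
      refine Topology.IsOpenEmbedding.of_comp _ hLopen.isOpenEmbedding_subtypeVal ?_
      exact hUopen.isOpenEmbedding_subtypeVal
    have hcomp : U.restrict (d.chart i) = (B.lateRegion d.τ₀).restrict (d.chart i) ∘ Set.inclusion hUL := by
      funext x; rfl
    rw [hcomp]
    exact hlc.isOpenEmbedding.comp hι
  · -- (G1c) image inside the hole region, hence in `d.charted`
    rintro _ ⟨x, hx, rfl⟩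
    exact FinalStateDecomposition.region_subset_charted d i ⟨x, lt_of_le_of_lt hτ₁ hx.1, rfl⟩
  · -- (G3) the slab out to the constant wall IS the truncated slab of radius `W₀`: structure, `Cᵏ → C²`
    have hset : ∀ τ, (Subtype.val '' {x : B.domain | B.time x.1 = τ ∧ B.radius x.1 ≤ W₀}) =
        Subtype.val '' B.truncTimeSlab W₀ τ := fun τ ↦ rfl
    refine tendsto_of_tendsto_of_tendsto_of_le_of_le tendsto_const_nhds
      (d.tendsto_truncDeviationCk i W₀) (fun _ ↦ zero_le) fun τ ↦ ?_
    rw [hset]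
    exact supCkENorm_mono_right _ hk _
  · -- (G4) the sign on the collar, by hypothesis
    intro x hxt hxR hxW
    exact hsign x hxt hxR hxW
  · -- (G5) relative closedness, from `Hc`(3)
    intro τ' ϱ hϱ hτ' _
    exact hclosed τ' ϱ hϱ (lt_of_le_of_lt hτ₁ hτ')

/-! ## §T Targets — the registered stubs of the picked line `Lines/Sketch.lean` (lead v1, 2026-08-17T01:57Z)
## and of the alternative skeleton `Lines/birth.lean` (planner BC3, 02:15Z)

Verdicts of this seat (paper unless a theorem follows; "load-bearing" = the stub becomes FALSE without it):

* M1 `OscillatoryJacobi` — TRUE.  `K := J′ + a′J` has `K′ = a′(K − a′J)`; Grönwall with `‖A‖ ≤ 2` on `[0,1]`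
  gives `|J| + |K| ≤ e²(1+δ)(|J 0| + |J′ 0|)`, whence `|J s − J 0 − s K 0| ≤ 3e²δ(|J 0| + |J′ 0|) < 23δ(…)`
  (constant `100` has room).  `δ = 0`: `a′ ≡ 0 ⇒ J` affine, both sides `0`.  No hypothesis droppable except
  `δ ≤ 1` (used only to bound `‖A‖`).
* M2 `ShearIncrementIBP` — TRUE (one integration by parts; `sSup` of `|F′|` over the compact `Icc` is a max
  since `F ∈ C²`; `u₁ = u₂` gives `0 ≤ …`).
* S1 `WallMajorant` — TRUE.  With `T₀` such that `ρ(u) ≤ u` for `u ≥ T₀`, `M(s) := sup_{T₀ ≤ u ≤ s} ρ⁺(u)` is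
  finite, monotone, sublinear; `W(s) := 2 + 3∫_s^{s+1} M` is continuous, monotone, sublinear and
  `≥ 3M(s) + 2 ≥ 3ρ(s) + 2` (`s ≥ T₀`).  (No measurability of `ρ` needed: `M` is monotone.)
* S2 `OrientationAnchorHolds` — TRUE, and with FEWER hypotheses than `HonestCore`: fix `i`, `R ≥ R₀`; by the
  STRUCTURE's fixed-radius convergence at radius `R` there is `T*` after which `dΨᵢ(Λᵢe₀)` is timelike on the
  shell `{R₀ ≤ rᵢ ≤ R}` (`g_{M,a}(e₀,e₀) = −1 + 2H ≤ −0.98` at `r ≥ 100M`, `Hc`(1); cone algebra = S3b, PROVED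
  below).  If at some late shell point it were PAST-directed, it is past-directed along the whole `Λᵢe₀`-ray
  from that point (timelike + continuity along the connected ray), a past-directed timelike curve `γ` inside
  `Ψᵢ(lateRegion) ⊆ O = J⁺(ιΣ) ∩ I⁻(charted)`.  Either `γ` has a past endpoint `p∞ ∈ M` — then `p∞ ∈ J⁻(γ(1))
  ⊆ I⁻(charted)` and `p∞ ∈ closure J⁺(ιΣ) = J⁺(ιΣ)` (Cauchy: `J⁺(Σ) = M ∖ I⁻(Σ)`), so `p∞ ∈ O`, and `Hc`(3)
  (tube profile `ϱ ≡ r*`) puts `p∞` in the image of a CLOSED tube portion, contradicting `t → ∞` along `γ`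
  through the open embedding — or `γ` is past-inextendible, and the inextendible timelike curve through
  `γ(0)` meets `ιΣ` exactly once: wherever it does, some point of `ιΣ` lies in `I⁺` of another
  (`γ ⊆ J⁺(ιΣ)`), against achronality.  USED: `Hc`(1), `Hc`(3), `O = exteriorOf`, `isCauchyHypersurface`,
  `IsLateChart`; NOT used: `Hc`(2), `Hc`(4), admissibility, maximality.  (So `Hc`(2) is possibly unnecessary
  for the whole decl — correcting §B: the sign has two independent anchors, `Hc`(2)+time function or
  `Hc`(3)+Cauchy achronality; the second is the tree-friendlier one — `CauchyDevelopmentAcausal`,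
  `CauchyHypersurfaceChronology`.)  Same verdict for `birth`'s `stub_causalHonesty` (G4) half; its (G5) half
  additionally needs a Cauchy time function (not in the tree: only stationary/DOC time functions exist,
  `StationaryOrbitTimeFunction`, `DocStationarySpacetime`) or a non-imprisonment lemma — TRUE, L-sized.
* S3a `BandAnchoredPaths` — TRUE (path: first along `+Λe₀`, then inward in the rest frame while advancing rest
  time at rate `≥ |v|`, so lab time `x⁰` never decreases and the monotone wall never drops below `r`; the
  Kerr–Schild radius is monotone along rest-frame rays: `d(r²)/d(|x̄′|²) ≥ 0`).  LOAD-BEARING: orthochronous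
  `0 < (Λe₀)⁰` (with `Λ = boost ∘ time-reversal`, `v ≠ 0`, a wall jumping just below `x⁰` and `x` far out on
  the side `v·x̄′ > |v|(R₁ + ½ + |a|)`, every admissible `S` must keep `z⁰ ≥ x⁰`, i.e. `v·z̄′ ≥ v·x̄′`, which no
  point of the anchor sphere satisfies — the stub's conclusion fails); `Monotone W` (a dip below `r` ahead in
  lab time blocks every forward path when `t x = τ₁`).  Both hypotheses are present — information only.
  KERNEL-CHECKED (p138588, `Theorems/NeckGapDecay/Negative/BandAnchoredPathsHypotheses.lean`):
  `not_bandAnchoredPaths_without_orthochronous` (`Λ = (−1)·boost(3/5,0,0)`, monotone step wall) and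
  `not_bandAnchoredPaths_without_monotone` (`boost(3/5,0,0)`, spike wall), models `M = a = 0`, `R₁ = 10`,
  `x = Λ(0, −1000, 0, 0)`: every band point has rest coordinate `z′¹ ≤ −1000`, so no anchor point `r = 10.5`.
* S3b `TimelikeOfSmallDeviation` — TRUE, PROVED below (`timelikeOfSmallDeviation`, verbatim statement; the
  worker closes the registered stub by `exact` after unfolding).  `0 ≤ M` enters only through `H ≤ 1/100`;
  the threshold `100M` is far from sharp (`r > 2.2M` would do for `a = 0`).
* P `GapConeCertificateHolds` — = the crux's physics with the wall GIVEN (∀ continuous monotone sublinear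
  `W ≥ 2`).  Constant walls reduce to §3 + S2 (consistent); huge finite values of `W` are harmless (fixed-radius
  convergence); walls far above `3ρᵢ + 2` keep `u = t − r → ∞`.  Not cheaper to attack than the crux; nothing
  found (§C).  `birth`'s `stub_analyticGapDecay` likewise (its extra wall normalisation — non-decreasing,
  slope `≤ 1/(10‖Λ‖²)` — is always available above a sublinear profile: `W(s) = sup_{u ≥ 0}(ḡ(s+u) − εu)`).

No stub is killed.  Targets broken: 0 / 9. -/

/-- Verbatim copy of S3b of `Lines/Sketch.lean` (`ConnectionLevelCones.TimelikeOfSmallDeviation`). -/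
def TimelikeOfSmallDeviation : Prop :=
  ∀ (𝓢 : Spacetime.{0} 4) (Λ : lorentzGroup) (c : E4) (M a : ℝ), 0 ≤ M →
    let B := boostedKerrBackground Λ c M a
    ∀ (Ψ : B.domain → 𝓢.carrier) (x : B.domain), 100 * M ≤ B.radius x.1 →
      ‖𝓢.deviation B Ψ x‖ ≤ 1 / (20 * ‖((Λ : E4 ≃L[ℝ] E4) : E4 →L[ℝ] E4)‖ ^ 2) →
      𝓢.metric.IsTimelike (mfderiv 𝓘(ℝ, E4) (𝓡 4) Ψ x ((Λ : E4 ≃L[ℝ] E4) (E4.basisVector 0)))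

/-- The Kerr–Schild scalar obeys `H ≤ 1/100` at Kerr–Schild radius `r ≥ 100 M` (`M ≥ 0`; for `M = 0`, `H = 0`). -/
theorem scalarH_le_of_radius_ge {M a : ℝ} (hM : 0 ≤ M) {y : E4} (hr : 100 * M ≤ Kerr.radius a y) :
    Kerr.scalarH M a y ≤ 1 / 100 := by
  rcases hM.eq_or_lt with hM0 | hMpos
  · simp [Kerr.scalarH, ← hM0]
  · set r := Kerr.radius a y with hrdef
    have hr0 : 0 < r := by linarith
    unfold Kerr.scalarH
    rw [← hrdef]
    have h1 : M * r ^ 3 / (r ^ 4 + a ^ 2 * y 3 ^ 2) ≤ M * r ^ 3 / r ^ 4 :=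
      div_le_div_of_nonneg_left (by positivity) (by positivity) (le_add_of_nonneg_right (by positivity))
    have h2 : M * r ^ 3 / r ^ 4 = M / r := by
      field_simp
    have h3 : M / r ≤ 1 / 100 := by
      rw [div_le_div_iff₀ hr0 (by norm_num)]; linarith
    linarith

/-- **Stub S3b is TRUE** (candidate proof for the worker; pointwise cone algebra):
`g(dΨ Λe₀, dΨ Λe₀) = dev(Λe₀, Λe₀) + g_{M,a}(Λ⁻¹Λe₀, Λ⁻¹Λe₀) = dev(Λe₀, Λe₀) − 1 + 2H`, with
`|dev(Λe₀, Λe₀)| ≤ ‖dev‖‖Λe₀‖² ≤ ‖dev‖‖Λ‖² ≤ 1/20` and `2H ≤ 1/50`: total `≤ −0.93 < 0`. -/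
theorem timelikeOfSmallDeviation : TimelikeOfSmallDeviation := by
  intro 𝓢 Λ c M a hM B Ψ x hr hdev
  set L : E4 := (Λ : E4 ≃L[ℝ] E4) (E4.basisVector 0) with hL
  -- the pulled-back length of `L` splits into deviation + boosted Kerr–Schild background
  have key : 𝓢.metric.val (Ψ x) (mfderiv 𝓘(ℝ, E4) (𝓡 4) Ψ x L) (mfderiv 𝓘(ℝ, E4) (𝓡 4) Ψ x L) =
      𝓢.deviation B Ψ x L L + B.bilin x.1 L L := by
    rw [Spacetime.deviation_apply]; ring
  -- background: `g_{M,a}(Λ⁻¹Λe₀, Λ⁻¹Λe₀) = −1 + 2H`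
  have hB : B.bilin x.1 L L = -1 + 2 * Kerr.scalarH M a (poincareInv Λ c x.1) := by
    show boostedKerrBilin Λ c M a x.1 L L = _
    rw [boostedKerrBilin_apply, hL, ContinuousLinearEquiv.symm_apply_apply, Kerr.bilin_apply,
      Kerr.nullCovector_basisVector_zero, Minkowski.bilin_basisVector_zero]
    ring
  have hH : Kerr.scalarH M a (poincareInv Λ c x.1) ≤ 1 / 100 := scalarH_le_of_radius_ge hM hr
  -- deviation: `|dev(L, L)| ≤ ‖dev‖ ‖L‖² ≤ ‖dev‖ ‖Λ‖² ≤ 1/20`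
  have hLn : ‖L‖ ≤ ‖((Λ : E4 ≃L[ℝ] E4) : E4 →L[ℝ] E4)‖ := by
    have h := ((Λ : E4 ≃L[ℝ] E4) : E4 →L[ℝ] E4).le_opNorm (E4.basisVector 0)
    have h1 : ‖(E4.basisVector 0 : E4)‖ = 1 := by
      simp [E4.basisVector]
    rw [h1, mul_one] at h
    exact h
  have hdevLL : |𝓢.deviation B Ψ x L L| ≤ 1 / 20 := by
    have h := (𝓢.deviation B Ψ x).le_opNorm₂ L L
    rw [Real.norm_eq_abs] at h
    set nΛ := ‖((Λ : E4 ≃L[ℝ] E4) : E4 →L[ℝ] E4)‖ with hnΛ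
    have hn0 : 0 ≤ nΛ := norm_nonneg _
    have hd0 : 0 ≤ ‖𝓢.deviation B Ψ x‖ := norm_nonneg _
    have h2 : ‖𝓢.deviation B Ψ x‖ * ‖L‖ * ‖L‖ ≤ ‖𝓢.deviation B Ψ x‖ * nΛ * nΛ := by
      have := norm_nonneg L
      gcongr
    have h3 : ‖𝓢.deviation B Ψ x‖ * nΛ * nΛ ≤ 1 / (20 * nΛ ^ 2) * nΛ * nΛ := by gcongr
    have h4 : 1 / (20 * nΛ ^ 2) * nΛ * nΛ ≤ 1 / 20 := by
      rcases hn0.eq_or_lt with h0 | hpos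
      · rw [← h0]; norm_num
      · have : 1 / (20 * nΛ ^ 2) * nΛ * nΛ = 1 / 20 := by field_simp
        rw [this]
    linarith
  show 𝓢.metric.val (Ψ x) (mfderiv 𝓘(ℝ, E4) (𝓡 4) Ψ x L) (mfderiv 𝓘(ℝ, E4) (𝓡 4) Ψ x L) < 0
  rw [key, hB]
  linarith [(abs_le.mp hdevLL).2]

/-! ## §6 Landed negative facts of the parent crux within reach (re-exported as `example`s) -/

/-- The parent's comoving-pair lemma (p123270 lineage): `ComovingPairWitness → ¬ NecksCertify`.  For THIS
decl the same physics makes DV load-bearing (§B), but no metric-free core exists, so nothing new is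
landed modulo `H′`. -/
example : Theorems.NecksCertify.Negative.ComovingPairWitness → ¬ Theses.StarvedNecks.NecksCertify :=
  Theorems.NecksCertify.Negative.NecksCertify_false_of_ComovingPairWitness

end Summit.FinalStateConjecture.FinalStateConjecture.Cruxes.NeckGapDecay.Disproof

end
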